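import Literature.Computability.QuantumAlgorithms.TrotterErrorFirstOrder
import HarnessLib

/-!
# Observable (Heisenberg-picture) error from an operator-norm implementation error

Topic `Literature/Computability/QuantumAlgorithms`. instance-level adjudication of specific advantage
claims; no claim about BQP vs BPP or the summit.

If a unitary (more generally a contraction) `U` is replaced by `V`, every observable `O` evolved in
the Heisenberg picture moves by at most `2‖O‖‖U − V‖` in operator norm:
`‖U⋆ O U − V⋆ O V‖ ≤ 2‖O‖‖U − V‖`. This is the operator form of the two-term splitting
`⟨ψ|U†MU|ψ⟩ − ⟨ψ|V†MV|ψ⟩ = ⟨ψ|U†M|Δ⟩ + ⟨Δ|MV|ψ⟩`, `|Δ⟩ = (U − V)|ψ⟩`, of Nielsen–Chuang's Box 4.1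
(eqs. (4.64)–(4.68): `|P_U − P_V| ≤ 2E(U,V)`), and it is the step that turns the product-formula
bounds of `TrotterErrorFirstOrder.lean` (Childs–Su–Tran–Wiebe–Zhu 2021, Props. 11–12) into bounds
on Trotterised expectation values — the quantity the Trotterised-dynamics advantage claims report.

## Contents
* `norm_star_mul_mul_sub_le` — `‖U⋆OU − V⋆OV‖ ≤ 2‖O‖‖U − V‖` for contractions `U`, `V` in a normed
  star ring with isometric star.
* `norm_heis_lieTrotter_sub_le_of_mem_skewAdjoint` / `norm_heis_strang_sub_le_of_mem_skewAdjoint` —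
  in a C⋆-algebra, for skew-adjoint generators (`x = −iA`, …): the Heisenberg-picture error of one
  first-order step is `≤ 2‖O‖·(t²/2)‖[x,y]‖` and of one second-order (Strang) step is
  `≤ 2‖O‖·(t³/6)(‖[y,[y,x]]‖ + ‖[x,[x,y]]‖)`.

## What is NOT here
State-level statements (`|⟨ψ|…|ψ⟩| ≤ …`, which follow by `|φ(a)| ≤ ‖a‖` for any state `φ`), the
`r`-step versions (combine with `norm_lieTrotter_sub_exp_le_comm` / the `r`-step second-order bound
in the same way), and anything about a particular Hamiltonian.

## References
* M. A. Nielsen, I. L. Chuang, *Quantum Computation and Quantum Information*, CUP 2010, §4.5.3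
  Box 4.1, eqs. (4.61)–(4.68) [NielsenChuang2010].
* A. M. Childs, Y. Su, M. C. Tran, N. Wiebe, S. Zhu, *Theory of Trotter error with commutator
  scaling*, Phys. Rev. X 11, 011020 (2021), §5.1 Propositions 11–12 [ChildsSuTranWiebeZhu2021].
-/


noncomputable section

namespace Literature.Computability.QuantumAlgorithms

open NormedSpace Set

section StarRing

variable {A : Type*} [NormedRing A] [StarRing A] [NormedStarGroup A]

/-- **Heisenberg-picture error from implementation error (operator form of Nielsen–Chuang Box 4.1).**
For contractions `U`, `V` and any `O`: `‖U⋆ O U − V⋆ O V‖ ≤ 2‖O‖‖U − V‖`, from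
`U⋆OU − V⋆OV = (U − V)⋆ O U + V⋆ O (U − V)` and `‖a⋆‖ = ‖a‖`.
[cite: NielsenChuang2010, §4.5.3 Box 4.1 eqs. (4.64)–(4.68) (the same two-term splitting, stated there for ⟨ψ|·|ψ⟩ of a POVM element)] -/
theorem norm_star_mul_mul_sub_le (O U V : A) (hU : ‖U‖ ≤ 1) (hV : ‖V‖ ≤ 1) :
    ‖star U * O * U - star V * O * V‖ ≤ 2 * ‖O‖ * ‖U - V‖ := by
  have hsplit : star U * O * U - star V * O * V =
      star (U - V) * O * U + star V * O * (U - V) := by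
    rw [star_sub]
    noncomm_ring
  rw [hsplit]
  have h1 : ‖star (U - V) * O * U‖ ≤ ‖U - V‖ * ‖O‖ * 1 := by
    calc ‖star (U - V) * O * U‖ ≤ ‖star (U - V)‖ * ‖O‖ * ‖U‖ :=
          (norm_mul_le _ _).trans (mul_le_mul_of_nonneg_right (norm_mul_le _ _) (norm_nonneg _))
      _ ≤ ‖U - V‖ * ‖O‖ * 1 := by rw [norm_star]; gcongr
  have h2 : ‖star V * O * (U - V)‖ ≤ 1 * ‖O‖ * ‖U - V‖ := by
    calc ‖star V * O * (U - V)‖ ≤ ‖star V‖ * ‖O‖ * ‖U - V‖ :=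
          (norm_mul_le _ _).trans (mul_le_mul_of_nonneg_right (norm_mul_le _ _) (norm_nonneg _))
      _ ≤ 1 * ‖O‖ * ‖U - V‖ := by rw [norm_star]; gcongr
  calc ‖star (U - V) * O * U + star V * O * (U - V)‖
      ≤ ‖star (U - V) * O * U‖ + ‖star V * O * (U - V)‖ := norm_add_le _ _
    _ ≤ ‖U - V‖ * ‖O‖ * 1 + 1 * ‖O‖ * ‖U - V‖ := add_le_add h1 h2
    _ = 2 * ‖O‖ * ‖U - V‖ := by ring

end StarRing

section CStar

open TrotterError

variable {A : Type*} [CStarAlgebra A]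

/-- **Observable error of one first-order Trotter step.** For skew-adjoint `x`, `y` (`x = −iA`,
`y = −iB`) in a C⋆-algebra, `t ≥ 0` and any observable `O`:
`‖(e^{tx}e^{ty})⋆ O (e^{tx}e^{ty}) − (e^{t(x+y)})⋆ O e^{t(x+y)}‖ ≤ 2‖O‖ · (t²/2)‖xy − yx‖`
(Nielsen–Chuang's splitting applied to Childs–Su–Tran–Wiebe–Zhu's first-order bound).
[cite: ChildsSuTranWiebeZhu2021, §5.1 Proposition 11 (Γ = 2); NielsenChuang2010, §4.5.3 Box 4.1 eqs. (4.64)–(4.68)] -/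
theorem norm_heis_lieTrotter_sub_le_of_mem_skewAdjoint {x y : A} (hx : x ∈ skewAdjoint A)
    (hy : y ∈ skewAdjoint A) {t : ℝ} (ht : 0 ≤ t) (O : A) :
    ‖star (exp (t • x) * exp (t • y)) * O * (exp (t • x) * exp (t • y)) -
        star (exp (t • (x + y))) * O * exp (t • (x + y))‖ ≤
      2 * ‖O‖ * (t ^ 2 / 2 * ‖x * y - y * x‖) := by
  have hxy : x + y ∈ skewAdjoint A := (skewAdjoint A).add_mem hx hy
  have hU : ‖exp (t • x) * exp (t • y)‖ ≤ 1 :=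
    (norm_mul_le _ _).trans (by
      have h1 := norm_exp_smul_le_one_of_mem_skewAdjoint hx t
      have h2 := norm_exp_smul_le_one_of_mem_skewAdjoint hy t
      nlinarith [norm_nonneg (exp (t • x)), norm_nonneg (exp (t • y))])
  have hV : ‖exp (t • (x + y))‖ ≤ 1 := norm_exp_smul_le_one_of_mem_skewAdjoint hxy t
  have hstep := norm_exp_mul_exp_sub_exp_add_le_comm x y ht
    (fun s _ => norm_exp_smul_le_one_of_mem_skewAdjoint hx s)
    (fun s _ => norm_exp_smul_le_one_of_mem_skewAdjoint hy s)
    (fun s _ => norm_exp_smul_le_one_of_mem_skewAdjoint hxy s)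
  calc _ ≤ 2 * ‖O‖ * ‖exp (t • x) * exp (t • y) - exp (t • (x + y))‖ :=
        norm_star_mul_mul_sub_le O _ _ hU hV
    _ ≤ 2 * ‖O‖ * (t ^ 2 / 2 * ‖x * y - y * x‖) := by gcongr

/-- **Observable error of one second-order (Strang / Suzuki) step.** For skew-adjoint `x`, `y`
(`x = −iA/2`, `y = −iB`) in a C⋆-algebra, `t ≥ 0` and any observable `O`, with
`S = e^{tx}e^{ty}e^{tx}`, `E = e^{t(x+y+x)}`:
`‖S⋆ O S − E⋆ O E‖ ≤ 2‖O‖ · (t³/6)(‖[y,[y,x]]‖ + ‖[x,[x,y]]‖)`.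
[cite: ChildsSuTranWiebeZhu2021, §5.1 Proposition 12 (Γ = 2); NielsenChuang2010, §4.5.3 Box 4.1 eqs. (4.64)–(4.68)] -/
theorem norm_heis_strang_sub_le_of_mem_skewAdjoint {x y : A} (hx : x ∈ skewAdjoint A)
    (hy : y ∈ skewAdjoint A) {t : ℝ} (ht : 0 ≤ t) (O : A) :
    ‖star (exp (t • x) * exp (t • y) * exp (t • x)) * O * (exp (t • x) * exp (t • y) * exp (t • x)) -
        star (exp (t • (x + y + x))) * O * exp (t • (x + y + x))‖ ≤
      2 * ‖O‖ * (t ^ 3 / 6 * (‖y * (y * x - x * y) - (y * x - x * y) * y‖ +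
        ‖x * (x * y - y * x) - (x * y - y * x) * x‖)) := by
  have hh : x + y + x ∈ skewAdjoint A := (skewAdjoint A).add_mem ((skewAdjoint A).add_mem hx hy) hx
  have e1 := norm_exp_smul_le_one_of_mem_skewAdjoint hx t
  have e2 := norm_exp_smul_le_one_of_mem_skewAdjoint hy t
  have hU : ‖exp (t • x) * exp (t • y) * exp (t • x)‖ ≤ 1 := by
    have h12 : ‖exp (t • x) * exp (t • y)‖ ≤ 1 :=
      (norm_mul_le _ _).trans (by nlinarith [norm_nonneg (exp (t • x)), norm_nonneg (exp (t • y))])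
    exact (norm_mul_le _ _).trans (by
      nlinarith [norm_nonneg (exp (t • x) * exp (t • y)), norm_nonneg (exp (t • x))])
  have hV : ‖exp (t • (x + y + x))‖ ≤ 1 := norm_exp_smul_le_one_of_mem_skewAdjoint hh t
  have hstep := norm_strang_sub_exp_le_of_mem_skewAdjoint hx hy ht
  have hK : 0 ≤ ‖y * (y * x - x * y) - (y * x - x * y) * y‖ +
      ‖x * (x * y - y * x) - (x * y - y * x) * x‖ := add_nonneg (norm_nonneg _) (norm_nonneg _)
  calc _ ≤ 2 * ‖O‖ * ‖exp (t • x) * exp (t • y) * exp (t • x) - exp (t • (x + y + x))‖ :=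
        norm_star_mul_mul_sub_le O _ _ hU hV
    _ ≤ _ := by gcongr

end CStar

end Literature.Computability.QuantumAlgorithms
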